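import Summits.Ventures.PercRepro.Night2ThreeTwoQSumRangeA
import Summits.Ventures.PercRepro.Night2ThreeTwoQSumRangeB
import Summits.Ventures.PercRepro.Night2ThreeTwoQSumRangeC
import Summits.Ventures.PercRepro.Night2ThreeTwoQSumTail

/-!
# PercRepro — the quadratic count sums hold for every `n ≥ 12` (night-2, gen 25)

The kernel range `12 ≤ n ≤ 30` (`Night2ThreeTwoQSumRangeA–C`, dispatched per `n`) and the tail `E_le_qSum_of_tail`
(`n ≥ 31`) together: **`E_le_qSum_of_twelve`** — `(n + 56)/(20 n) ≤ qSum (n − y) y i₀ j₀ n` for every `n ≥ 12`,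
`3 ≤ y ≤ 6` and every basis profile (`i₀ ≤ 2`, `i₀ + j₀ = 4`, `j₀ ≤ y`); `E_le_qSum_of_thirteen` is its restriction.
-/

namespace PercRepro.Shadow

/-- The kernel range `12 ≤ n ≤ 30`. -/
theorem E_le_qSum_of_range (n y i₀ j₀ : ℕ) (hn : 12 ≤ n) (hn' : n ≤ 30) (hy3 : 3 ≤ y) (hy6 : y ≤ 6)
    (hi₀ : i₀ ≤ 2) (hij : i₀ + j₀ = 4) (hj₀ : j₀ ≤ y) :
    ((n : ℚ) + 56) / (20 * (n : ℚ)) ≤ qSum (n - y) y i₀ j₀ n := by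
  have hj : j₀ = 4 - i₀ := by omega
  subst hj
  interval_cases n <;> simp only [Nat.cast_ofNat]
  · exact E_le_qSum_at_12 y i₀ hy3 hy6 hi₀ hj₀
  · exact E_le_qSum_at_13 y i₀ hy3 hy6 hi₀ hj₀
  · exact E_le_qSum_at_14 y i₀ hy3 hy6 hi₀ hj₀
  · exact E_le_qSum_at_15 y i₀ hy3 hy6 hi₀ hj₀
  · exact E_le_qSum_at_16 y i₀ hy3 hy6 hi₀ hj₀
  · exact E_le_qSum_at_17 y i₀ hy3 hy6 hi₀ hj₀
  · exact E_le_qSum_at_18 y i₀ hy3 hy6 hi₀ hj₀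
  · exact E_le_qSum_at_19 y i₀ hy3 hy6 hi₀ hj₀
  · exact E_le_qSum_at_20 y i₀ hy3 hy6 hi₀ hj₀
  · exact E_le_qSum_at_21 y i₀ hy3 hy6 hi₀ hj₀
  · exact E_le_qSum_at_22 y i₀ hy3 hy6 hi₀ hj₀
  · exact E_le_qSum_at_23 y i₀ hy3 hy6 hi₀ hj₀
  · exact E_le_qSum_at_24 y i₀ hy3 hy6 hi₀ hj₀
  · exact E_le_qSum_at_25 y i₀ hy3 hy6 hi₀ hj₀
  · exact E_le_qSum_at_26 y i₀ hy3 hy6 hi₀ hj₀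
  · exact E_le_qSum_at_27 y i₀ hy3 hy6 hi₀ hj₀
  · exact E_le_qSum_at_28 y i₀ hy3 hy6 hi₀ hj₀
  · exact E_le_qSum_at_29 y i₀ hy3 hy6 hi₀ hj₀
  · exact E_le_qSum_at_30 y i₀ hy3 hy6 hi₀ hj₀

/-- **The quadratic count sums for every `n ≥ 12`.** -/
theorem E_le_qSum_of_twelve (n y i₀ j₀ : ℕ) (hn : 12 ≤ n) (hy3 : 3 ≤ y) (hy6 : y ≤ 6)
    (hi₀ : i₀ ≤ 2) (hij : i₀ + j₀ = 4) (hj₀ : j₀ ≤ y) :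
    ((n : ℚ) + 56) / (20 * (n : ℚ)) ≤ qSum (n - y) y i₀ j₀ n := by
  rcases Nat.lt_or_ge n 31 with h | h
  · exact E_le_qSum_of_range n y i₀ j₀ hn (by omega) hy3 hy6 hi₀ hij hj₀
  · exact E_le_qSum_of_tail n y i₀ j₀ h hy3 hy6 (by omega) hi₀ hij hj₀

/-- The sums for every `n ≥ 13`. -/
theorem E_le_qSum_of_thirteen (n y i₀ j₀ : ℕ) (hn : 13 ≤ n) (hy3 : 3 ≤ y) (hy6 : y ≤ 6)
    (hi₀ : i₀ ≤ 2) (hij : i₀ + j₀ = 4) (hj₀ : j₀ ≤ y) :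
    ((n : ℚ) + 56) / (20 * (n : ℚ)) ≤ qSum (n - y) y i₀ j₀ n :=
  E_le_qSum_of_twelve n y i₀ j₀ (by omega) hy3 hy6 hi₀ hij hj₀

end PercRepro.Shadow
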